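import Literature.Geometry.Riemannian.CanonicalNeighbourhoods
import Literature.Geometry.Lorentzian.VolumeSmallBalls
import HarnessLib

/-!
# Small geodesic balls, the halving iteration, and the reduction of Perelman's no local
# collapsing theorem to its entropy half (Topping 2006, §8.3)

Companion (proof file) of `CanonicalNeighbourhoods.lean`, which vends Perelman's no local
collapsing theorem I (2002, §4, Thm. 4.1) as the named fact `perelman_noLocalCollapsing` over the
vocabulary `PseudoRiemannianMetric.ball` (geodesic balls `B(x, r)` of the length distance) and
`PseudoRiemannianMetric.vol` (Riemannian volume, the Euclidean-normalised Hausdorff measure of the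
length distance). In that vocabulary this file proves:

* `PseudoRiemannianMetric.exists_nhds_mul_pow_le_vol_ball` — small balls of a fixed Riemannian
  metric have volume `≥ c · rⁿ`, locally uniformly in the centre (`0 < r ≤ ρ`);
* `PseudoRiemannianMetric.exists_mul_pow_le_vol_ball` — on a compact manifold one constant
  `c = c(g, R) > 0` serves all centres and all radii `0 < r ≤ R`;
* `isKappaNoncollapsed_const` — hence a static family `t ↦ g₀` is `κ`-noncollapsed
  (`IsKappaNoncollapsed`) on every scale `r₀ ≤ R` for some `κ = κ(g₀, R) > 0` (non-vacuity of the
  parabolic `κ`-noncollapsing predicate);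
* `PseudoRiemannianMetric.ofReal_mul_pow_le_vol_ball_of_doubling` — **the volume-ratio halving
  iteration** of Topping's proof of Thm. 8.3.1: if on all scales `0 < s ≤ r` the doubling property
  `Vol B(p,s) ≤ 2ⁿ⁺¹ Vol B(p,s/2)` forces `ξ sⁿ ≤ Vol B(p,s)`, then `ξ rⁿ ≤ Vol B(p,r)`;
* `perelman_noLocalCollapsing_of_entropyDichotomy` — **reduction of the named fact to its
  entropy half**: if every Ricci flow on a closed manifold on `[0,T)` admits `ξ > 0` with
  "curvature `≤ s⁻²` on `B_{t₀}(p,s)` and doubling at scale `s < √T` imply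
  `ξ sⁿ ≤ Vol_{t₀} B_{t₀}(p,s)`" (the consequence (8.3.11) of the `𝒲`-entropy monotonicity and
  of `μ > -∞`, Topping 2006, Prop. 8.2.1, Lemma 8.1.8, Thm. 8.3.4), then
  `perelman_noLocalCollapsing` holds with `κ = ξ`.

The first two are transports of `Literature/Geometry/Lorentzian/VolumeSmallBalls.lean`
(`exists_nhds_mul_pow_le_riemannianVolume`, `exists_mul_pow_le_riemannianVolume_of_compactSpace`)
along the identifications `g.vol = riemannianMeasure (g.toContMDiffRiemannianMetric hg)` and
`g.ball p r = {y | d_g(p, y) < r}`.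

**What is and is not here.** Topping's printed iteration (§8.3, end of the proof of Thm. 8.3.1)
shows `𝒦(p,s) ≤ ξ ⇒ 𝒦(p,s/2) ≤ 𝒦(p,s)` for the volume ratio `𝒦(p,s) = s⁻ⁿ 𝒱(p,s)` and
concludes from `lim_{s↓0} 𝒦(p,s) = ω_n > ξ`; we arrange the constant (`2ⁿ⁺¹` in the doubling
property, i.e. `ξ = e^{γ - 2ⁿ⁺²}` instead of `e^{γ - 2ⁿ⁺¹}`) so that each halving at least halves
`𝒦`, whence only `liminf_{s↓0} 𝒦(p,s) > 0` (`exists_nhds_mul_pow_le_vol_ball`) is consumed. The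
entropy half — the `𝒲`-functional, `μ(g,τ) > -∞` on closed manifolds, its monotonicity along
the flow (which needs the backward conjugate heat equation), and the test-function estimate
Lemma 8.3.5 — is NOT in the tree: `perelman_noLocalCollapsing` remains a named fact, and
`perelman_noLocalCollapsing_of_entropyDichotomy` takes that half as an explicit hypothesis.

## References

* G. Perelman, *The entropy formula for the Ricci flow and its geometric applications*,
  arXiv:math/0211159 (2002), §4, Thm. 4.1, Def. 4.2. [Perelman2002]
* P. Topping, *Lectures on the Ricci flow*, LMS Lecture Note Series 325, CUP 2006, §8.1
  (Lemma 8.1.8), §8.2 (Prop. 8.2.1), §8.3 (Thm. 8.3.1, Thm. 8.3.4, Lemma 8.3.5, (8.3.11)).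
  [Topping2006]
* I. Chavel, *Riemannian Geometry: A Modern Introduction*, 2nd ed., CUP 2006, §III.3 (volume of
  metric disks), Thm. III.4.2 (Günther–Bishop). [Chavel2006]
-/

noncomputable section

open Bundle Set Module Filter MeasureTheory Manifold
open scoped ContDiff Topology ENNReal NNReal

namespace Literature.Geometry.Riemannian

open Lorentzian

universe u v w

variable {E : Type*} [NormedAddCommGroup E] [NormedSpace ℝ E] [FiniteDimensional ℝ E]
  {H : Type*} [TopologicalSpace H] {I : ModelWithCorners ℝ E H} {M : Type*} [TopologicalSpace M]
  [ChartedSpace H M] [IsManifold I ∞ M] {n : ℕ∞ω} [T3Space M] [MeasurableSpace M] [BorelSpace M]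

/-! ### The vocabulary of `CanonicalNeighbourhoods.lean` vs. `Volume.lean` -/

omit [T3Space M] [MeasurableSpace M] [BorelSpace M] in
/-- The geodesic ball `g.ball p r` of a Riemannian `g` is the ball `{y | d(p, y) < r}` of the
length distance `riemannianEDist` for the Riemannian bundle structure of
`g.toContMDiffRiemannianMetric hg` (the structure used inside `riemannianVolume`). [folklore] -/
theorem _root_.Literature.Geometry.Lorentzian.PseudoRiemannianMetric.ball_eq_setOf_riemannianEDist_lt
    {g : PseudoRiemannianMetric I n E (TangentSpace I : M → Type _)} (hg : g.IsRiemannian) (p : M)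
    (r : ℝ≥0∞) :
    g.ball p r = {y | (letI : RiemannianBundle (fun x : M ↦ TangentSpace I x) :=
      ⟨(g.toContMDiffRiemannianMetric hg).toContinuousRiemannianMetric.toRiemannianMetric⟩;
      riemannianEDist I p y) < r} := by
  ext y
  simp only [PseudoRiemannianMetric.mem_ball, PseudoRiemannianMetric.riemEDist_eq hg]
  rfl

/-- The volume `g.vol (g.ball p r)` of a geodesic ball of a Riemannian `g` is the Riemannian
volume (`riemannianVolume`, `Volume.lean`) of the corresponding length-distance ball of
`g.toContMDiffRiemannianMetric hg`. [folklore] -/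
theorem _root_.Literature.Geometry.Lorentzian.PseudoRiemannianMetric.vol_ball_eq
    {g : PseudoRiemannianMetric I n E (TangentSpace I : M → Type _)} (hg : g.IsRiemannian) (p : M)
    (r : ℝ≥0∞) :
    g.vol (g.ball p r) = riemannianVolume (g.toContMDiffRiemannianMetric hg) (finrank ℝ E)
      {y | (letI : RiemannianBundle (fun x : M ↦ TangentSpace I x) :=
        ⟨(g.toContMDiffRiemannianMetric hg).toContinuousRiemannianMetric.toRiemannianMetric⟩;
        riemannianEDist I p y) < r} := by
  rw [PseudoRiemannianMetric.vol, PseudoRiemannianMetric.riemVolume_eq hg,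
    PseudoRiemannianMetric.ball_eq_setOf_riemannianEDist_lt hg]
  rfl

/-! ### Small geodesic balls of a fixed Riemannian metric -/

/-- **Small geodesic balls have volume at least `c · rⁿ`, locally uniformly**: for a Riemannian
`g` (a `C^k` `PseudoRiemannianMetric` which is positive definite) on a boundaryless manifold of
dimension `n = dim E` and every `x`, there are `c > 0`, `ρ > 0` and a neighbourhood `V` of `x`
with `c · rⁿ ≤ Vol_g (B_g(p, r))` for all `p ∈ V` and `0 < r ≤ ρ`. In particular
`liminf_{r↓0} r⁻ⁿ Vol_g B_g(x, r) > 0` — the smoothness input of the volume-ratio iteration in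
Topping 2006, proof of Thm. 8.3.1 (sharp form: Günther–Bishop, Chavel 2006, Thm. III.4.2).
[folklore] -/
theorem _root_.Literature.Geometry.Lorentzian.PseudoRiemannianMetric.exists_nhds_mul_pow_le_vol_ball
    [I.Boundaryless] {g : PseudoRiemannianMetric I n E (TangentSpace I : M → Type _)}
    (hg : g.IsRiemannian) (x : M) :
    ∃ c : ℝ, 0 < c ∧ ∃ ρ : ℝ, 0 < ρ ∧ ∃ V ∈ 𝓝 x, ∀ p ∈ V, ∀ r : ℝ, 0 < r → r ≤ ρ →
      ENNReal.ofReal (c * r ^ finrank ℝ E) ≤ g.vol (g.ball p (ENNReal.ofReal r)) := by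
  obtain ⟨c, hc, ρ, hρ, V, hV, h⟩ :=
    exists_nhds_mul_pow_le_riemannianVolume (I := I) (g.toContMDiffRiemannianMetric hg) x
  refine ⟨c, hc, ρ, hρ, V, hV, fun p hp r hr hrρ ↦ ?_⟩
  rw [PseudoRiemannianMetric.vol_ball_eq hg]
  exact h p hp r hr hrρ

/-- **Closed manifolds: geodesic balls of radius `≤ R` have volume `≥ c · rⁿ`**: for a Riemannian
`g` on a compact boundaryless manifold of dimension `n = dim E` and every `R` there is
`c = c(g, R) > 0` with `c · rⁿ ≤ Vol_g (B_g(p, r))` for all `p` and all `0 < r ≤ R` (Chavel 2006,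
§III.3 and Thm. III.4.2, uniformly by compactness). [folklore] -/
theorem _root_.Literature.Geometry.Lorentzian.PseudoRiemannianMetric.exists_mul_pow_le_vol_ball
    [I.Boundaryless] [CompactSpace M] {g : PseudoRiemannianMetric I n E (TangentSpace I : M → Type _)}
    (hg : g.IsRiemannian) (R : ℝ) :
    ∃ c : ℝ, 0 < c ∧ ∀ (p : M) (r : ℝ), 0 < r → r ≤ R →
      ENNReal.ofReal (c * r ^ finrank ℝ E) ≤ g.vol (g.ball p (ENNReal.ofReal r)) := by
  obtain ⟨c, hc, h⟩ :=
    exists_mul_pow_le_riemannianVolume_of_compactSpace (I := I) (g.toContMDiffRiemannianMetric hg) R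
  refine ⟨c, hc, fun p r hr hrR ↦ ?_⟩
  rw [PseudoRiemannianMetric.vol_ball_eq hg]
  exact h p r hr hrR

/-! ### Non-vacuity of `κ`-noncollapsing: static families -/

/-- **A static family is `κ`-noncollapsed on bounded scales.** For a Riemannian `g₀` on a closed
manifold (compact, boundaryless) and every `R` there is `κ = κ(g₀, R) > 0` such that the constant
family `t ↦ g₀` (with any connections, on any time set) is `κ`-noncollapsed for every scale
`0 < r₀ ≤ R` in the parabolic sense `IsKappaNoncollapsed` of Chen–Zhu 2006, §3 — by
`exists_mul_pow_le_vol_ball`; the curvature hypothesis is not needed. (Non-vacuity of the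
predicate in which `perelman_noLocalCollapsing` is stated.) [folklore] -/
theorem isKappaNoncollapsed_const [I.Boundaryless] [CompactSpace M]
    {g₀ : PseudoRiemannianMetric I ∞ E (TangentSpace I : M → Type _)} (hg₀ : g₀.IsRiemannian)
    (cov : ℝ → CovariantDerivative I E (TangentSpace I : M → Type _)) (S : Set ℝ) (R : ℝ) :
    ∃ κ : ℝ, 0 < κ ∧ ∀ r₀ : ℝ, 0 < r₀ → r₀ ≤ R →
      IsKappaNoncollapsed (fun _ : ℝ ↦ g₀) cov S κ r₀ := by
  obtain ⟨c, hc, h⟩ := PseudoRiemannianMetric.exists_mul_pow_le_vol_ball (I := I) hg₀ R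
  exact ⟨c, hc, fun r₀ hr₀ hr₀R x₀ t₀ _ _ ↦ h x₀ r₀ hr₀ hr₀R⟩

/-! ### The volume-ratio halving iteration (Topping 2006, proof of Thm. 8.3.1) -/

/-- **Volume-ratio halving iteration** (the last step of the proof of no local collapsing,
Topping 2006, §8.3, proof of Thm. 8.3.1 (last paragraph): "Claim: If `s ∈ (0, r]` and
`𝒦(p, s) ≤ ξ` then `𝒦(p, s/2) ≤ ξ` … Using this claim iteratively … this contradicts the limit
`lim_{s↓0} 𝒦(p, s) = ω_n`", here with the constant arranged so that only
`liminf_{s↓0} 𝒦(p, s) > 0` is needed). Let `g` be a Riemannian metric on a boundaryless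
manifold of dimension `n = dim E`, `p` a point, `r > 0`, `ξ > 0`, and suppose the **doubling
dichotomy** on all scales `0 < s ≤ r`: if `Vol B(p, s) ≤ 2ⁿ⁺¹ · Vol B(p, s/2)` then
`ξ sⁿ ≤ Vol B(p, s)`. Then `ξ rⁿ ≤ Vol B(p, r)`. Indeed, if `Vol B(p, r) < ξ rⁿ` then doubling
fails at `s = r`, so the volume ratio `𝒦(p, s) = s⁻ⁿ Vol B(p, s)` drops by a factor `< 1/2` from
`r` to `r/2`; inductively `𝒦(p, 2⁻ᵐ r) < 2⁻ᵐ ξ → 0`, contradicting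
`exists_nhds_mul_pow_le_vol_ball` (small balls have volume `≥ c sⁿ`). (In Perelman's theorem the
dichotomy is supplied by the `𝒲`-entropy: Topping 2006, (8.3.11).)
[cite: Topping2006, §8.3, proof of Thm. 8.3.1] -/
theorem _root_.Literature.Geometry.Lorentzian.PseudoRiemannianMetric.ofReal_mul_pow_le_vol_ball_of_doubling
    [I.Boundaryless] {g : PseudoRiemannianMetric I n E (TangentSpace I : M → Type _)}
    (hg : g.IsRiemannian) (p : M) {r ξ : ℝ} (hr : 0 < r) (hξ : 0 < ξ)
    (hD : ∀ s : ℝ, 0 < s → s ≤ r →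
      g.vol (g.ball p (ENNReal.ofReal s)) ≤
          2 ^ (finrank ℝ E + 1) * g.vol (g.ball p (ENNReal.ofReal (s / 2))) →
        ENNReal.ofReal (ξ * s ^ finrank ℝ E) ≤ g.vol (g.ball p (ENNReal.ofReal s))) :
    ENNReal.ofReal (ξ * r ^ finrank ℝ E) ≤ g.vol (g.ball p (ENNReal.ofReal r)) := by
  by_contra hlt
  rw [not_le] at hlt
  -- the volumes `V m = Vol B(p, 2⁻ᵐ r)` and the bounds `b m = ξ (2⁻ᵐ r)ⁿ / 2ᵐ`
  set V : ℕ → ℝ≥0∞ := fun m ↦ g.vol (g.ball p (ENNReal.ofReal (r / 2 ^ m))) with hV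
  set b : ℕ → ℝ := fun m ↦ ξ * (r / 2 ^ m) ^ finrank ℝ E / 2 ^ m with hb
  have h2 : (2 : ℝ≥0∞) ^ (finrank ℝ E + 1) ≠ 0 := pow_ne_zero _ two_ne_zero
  have h2' : (2 : ℝ≥0∞) ^ (finrank ℝ E + 1) ≠ ⊤ := ENNReal.pow_ne_top ENNReal.ofNat_ne_top
  -- the scaling identity `2ⁿ⁺¹ · b (m+1) = b m`
  have hbsucc : ∀ m : ℕ, (2 : ℝ≥0∞) ^ (finrank ℝ E + 1) * ENNReal.ofReal (b (m + 1)) =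
      ENNReal.ofReal (b m) := by
    intro m
    have h2r : (2 : ℝ≥0∞) ^ (finrank ℝ E + 1) = ENNReal.ofReal ((2 : ℝ) ^ (finrank ℝ E + 1)) := by
      rw [ENNReal.ofReal_pow zero_le_two, ENNReal.ofReal_ofNat]
    rw [h2r, ← ENNReal.ofReal_mul (by positivity), hb]
    congr 1
    simp only [pow_succ, div_pow]
    field_simp
    ring
  -- claim: `V m < b m` for all `m`, by induction (doubling must fail at every step)
  have hclaim : ∀ m : ℕ, V m < ENNReal.ofReal (b m) := by
    intro m
    induction m with
    | zero => simpa [hV, hb] using hlt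
    | succ m ih =>
      have hs : 0 < r / 2 ^ m := by positivity
      have hsr : r / 2 ^ m ≤ r := div_le_self hr.le (one_le_pow₀ one_le_two)
      have hrad : r / 2 ^ (m + 1) = r / 2 ^ m / 2 := by rw [pow_succ, div_div]
      -- doubling fails at `s = r / 2^m`
      have hfail : V m > 2 ^ (finrank ℝ E + 1) * V (m + 1) := by
        by_contra hdoub
        rw [not_lt] at hdoub
        have hdoub' : g.vol (g.ball p (ENNReal.ofReal (r / 2 ^ m))) ≤
            2 ^ (finrank ℝ E + 1) * g.vol (g.ball p (ENNReal.ofReal (r / 2 ^ m / 2))) := by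
          rw [← hrad]; exact hdoub
        have h1 := hD (r / 2 ^ m) hs hsr hdoub'
        have hbm : ENNReal.ofReal (b m) ≤ ENNReal.ofReal (ξ * (r / 2 ^ m) ^ finrank ℝ E) :=
          ENNReal.ofReal_le_ofReal (div_le_self (by positivity) (one_le_pow₀ one_le_two))
        exact absurd (ih.trans_le (hbm.trans h1)) (lt_irrefl _)
      -- hence `2ⁿ⁺¹ V (m+1) < V m < b m = 2ⁿ⁺¹ b (m+1)`
      rw [← ENNReal.mul_lt_mul_iff_right h2 h2', hbsucc m]
      exact hfail.trans ih
  -- small balls have volume `≥ c sⁿ`: contradiction for `m` large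
  obtain ⟨c, hc, ρ, hρ, U, hU, hsmall⟩ :=
    PseudoRiemannianMetric.exists_nhds_mul_pow_le_vol_ball (I := I) hg p
  have hpU : p ∈ U := mem_of_mem_nhds hU
  have ht₁ : Tendsto (fun m : ℕ ↦ r / 2 ^ m) atTop (𝓝 0) :=
    tendsto_const_nhds.div_atTop (tendsto_pow_atTop_atTop_of_one_lt one_lt_two)
  have ht₂ : Tendsto (fun m : ℕ ↦ ξ / 2 ^ m) atTop (𝓝 0) :=
    tendsto_const_nhds.div_atTop (tendsto_pow_atTop_atTop_of_one_lt one_lt_two)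
  obtain ⟨m, hm₁, hm₂⟩ := ((ht₁.eventually (Iic_mem_nhds hρ)).and
    (ht₂.eventually (Iio_mem_nhds hc))).exists
  have hsm : 0 < r / 2 ^ m := by positivity
  have hlow := hsmall p hpU (r / 2 ^ m) hsm hm₁
  have hup := hclaim m
  have hbpos : 0 < b m := by positivity
  have hineq : c * (r / 2 ^ m) ^ finrank ℝ E < b m :=
    (ENNReal.ofReal_lt_ofReal_iff hbpos).1 (hlow.trans_lt hup)
  have : c < ξ / 2 ^ m := by
    have hpow : 0 < (r / 2 ^ m) ^ finrank ℝ E := by positivity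
    rw [hb] at hineq
    have : c * (r / 2 ^ m) ^ finrank ℝ E < ξ / 2 ^ m * (r / 2 ^ m) ^ finrank ℝ E := by
      calc c * (r / 2 ^ m) ^ finrank ℝ E < ξ * (r / 2 ^ m) ^ finrank ℝ E / 2 ^ m := hineq
        _ = ξ / 2 ^ m * (r / 2 ^ m) ^ finrank ℝ E := by ring
    exact lt_of_mul_lt_mul_right this hpow.le
  exact absurd this (not_lt.2 hm₂.le)

/-! ### Reduction of `perelman_noLocalCollapsing` to the entropy dichotomy bound -/

/-- **No local collapsing from the entropy dichotomy bound.** Perelman's proof of the no local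
collapsing theorem I (2002, §4, Thm. 4.1), in Topping's presentation (2006, Thm. 8.3.1), splits
into an *analytic* half — the `𝒲`-entropy bound (8.3.11): along a Ricci flow on a closed manifold
on `[0, T)`, `T < ∞`, there is `γ = γ(n, g(0), T)` with
`γ ≤ 2 𝒱(p,s)/𝒱(p,s/2) + ln [s⁻ⁿ 𝒱(p,s)]` for every slice `g(t₀)`, every `p` and every scale
`0 < s < √T` at which `|R| ≤ s⁻²` on `B_{t₀}(p, s)` (monotonicity of `μ`, Prop. 8.2.1; `μ`
bounded below, Lemma 8.1.8; the test-function estimate, Lemma 8.3.5/Thm. 8.3.4; with the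
frame-wise bound `|Rm| ≤ s⁻²` used here one has `|R| ≤ n² s⁻²` and the factor `2` becomes
`1 + n²`, Rem. 8.3.2) — and a *geometric* half, the halving iteration
(`ofReal_mul_pow_le_vol_ball_of_doubling`). This theorem
is the geometric half as a reduction: **if** every Ricci flow of Riemannian metrics on `[0, T)`,
`0 < T`, on a closed manifold admits `ξ > 0` such that for all `t₀ ∈ [0, T)`, `p`, `0 < s < √T`
with curvature bounded by `s⁻²` (frame-wise, `CurvatureBoundedOn`) on `B_{t₀}(p, s)` and with the
doubling property `Vol_{t₀} B_{t₀}(p, s) ≤ 2ⁿ⁺¹ Vol_{t₀} B_{t₀}(p, s/2)` one has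
`ξ sⁿ ≤ Vol_{t₀} B_{t₀}(p, s)` (the consequence of (8.3.11): `ln [s⁻ⁿ 𝒱(p,s)] ≥ γ - (1 + n²) 2ⁿ⁺¹`
under doubling), **then** `perelman_noLocalCollapsing` holds, with `κ = ξ`. NOT a discharge of
the named fact: the hypothesis is the (unformalised) entropy half.
[cite: Topping2006, §8.3, Thm. 8.3.1 and (8.3.11)] -/
theorem perelman_noLocalCollapsing_of_entropyDichotomy
    (hE : ∀ {E : Type u} [NormedAddCommGroup E] [NormedSpace ℝ E] [FiniteDimensional ℝ E]
      {H : Type v} [TopologicalSpace H] (I : ModelWithCorners ℝ E H) [I.Boundaryless]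
      (M : Type w) [TopologicalSpace M] [T2Space M] [SecondCountableTopology M] [CompactSpace M]
      [ChartedSpace H M] [IsManifold I ∞ M] [MeasurableSpace M] [BorelSpace M] (T : ℝ), 0 < T →
      ∀ (g : ℝ → PseudoRiemannianMetric I ∞ E (TangentSpace I : M → Type _))
        (cov : ℝ → CovariantDerivative I E (TangentSpace I : M → Type _)),
        IsRicciFlow g cov (Ico 0 T) → (∀ t ∈ Ico 0 T, (g t).IsRiemannian) →
          ∃ ξ : ℝ, 0 < ξ ∧ ∀ t₀ ∈ Ico 0 T, ∀ (p : M) (s : ℝ), 0 < s → s < Real.sqrt T →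
            CurvatureBoundedOn (g t₀) (cov t₀) ((g t₀).ball p (ENNReal.ofReal s)) (s⁻¹ ^ 2) →
            (g t₀).vol ((g t₀).ball p (ENNReal.ofReal s)) ≤
              2 ^ (finrank ℝ E + 1) * (g t₀).vol ((g t₀).ball p (ENNReal.ofReal (s / 2))) →
            ENNReal.ofReal (ξ * s ^ finrank ℝ E) ≤ (g t₀).vol ((g t₀).ball p (ENNReal.ofReal s))) :
    perelman_noLocalCollapsing.{u, v, w} := by
  intro E _ _ _ H _ I _ M _ _ _ _ _ _ _ _ T hT g cov hflow hRiem
  obtain ⟨ξ, hξ, hdich⟩ := hE I M T hT g cov hflow hRiem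
  refine ⟨ξ, hξ, fun r₀ hr₀ hr₀T x₀ t₀ hS hcurv ↦ ?_⟩
  have ht₀ : t₀ ∈ Icc (t₀ - r₀ ^ 2) t₀ := ⟨by nlinarith, le_rfl⟩
  have ht₀' : t₀ ∈ Ico 0 T := hS ht₀
  refine PseudoRiemannianMetric.ofReal_mul_pow_le_vol_ball_of_doubling (hRiem t₀ ht₀') x₀ hr₀ hξ
    fun s hs hsr hdoub ↦ hdich t₀ ht₀' x₀ s hs (hsr.trans_lt hr₀T) ?_ hdoub
  -- curvature `≤ r₀⁻² ≤ s⁻²` on `B_{t₀}(x₀, s) ⊆ B_{t₀}(x₀, r₀)`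
  refine (hcurv t₀ ht₀).mono (PseudoRiemannianMetric.ball_mono _ _ (ENNReal.ofReal_le_ofReal hsr)) ?_
  gcongr

end Literature.Geometry.Riemannian

end
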